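import Mathlib.Analysis.SpecialFunctions.Complex.Log
import Mathlib.Analysis.SpecialFunctions.Complex.Arg
import Mathlib.Analysis.SpecialFunctions.Pow.Asymptotics
import Mathlib.Analysis.SpecialFunctions.Log.Basic
import Mathlib.RingTheory.MvPolynomial.Basic
import Literature.NumberTheory.Transcendental.ExpDominantSolvabilityContraction
import HarnessLib

/-!
# Exponential points by puncture decoupling — lemmas

Auxiliary lemmas for `Summits/Schanuel/Schanuel/Theorems/ZilberEacComplexPunctureDecoupling.lean`
(a new case of Zilber's Exponential-Algebraic Closedness for `ℂ_exp` inside the first open rung,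
`dim π₁(V) = n - 1`; Mantova–Masser, PLMS 129 (2024), p. 5): the contraction step
`exists_exp_eq_affine_add` (a repackaging of the D'Aquino–Fornasiero–Terzo/Masser Newton-step
lemma `Literature.NumberTheory.Transcendental.ExpDominant.exists_exp_eq_one_add`), and the
elementary asymptotics of the affine lattice sequences `αₘ = a · 2πi q m + b`.
-/

noncomputable section

open Complex MvPolynomial Metric Set Filter Topology

set_option linter.dupNamespace false

namespace Summit.Schanuel.Schanuel.Theorems

/-- Polynomial functions `z ↦ p(z)` on `ℂ^ι` are complex differentiable (induction on `p`).
[folklore] -/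
theorem differentiable_mvPolynomial_eval {ι : Type*} [Fintype ι] (p : MvPolynomial ι ℂ) :
    Differentiable ℂ fun z : ι → ℂ => eval z p := by
  induction p using MvPolynomial.induction_on with
  | C a => simp only [eval_C]; exact differentiable_const a
  | add p q hp hq => simp only [map_add]; exact hp.add hq
  | mul_X p i hp => simp only [map_mul, eval_X]; exact hp.mul (differentiable_apply i)

/-- `‖log z‖ ≤ log ‖z‖ + π` for `‖z‖ ≥ 1` (real part `log ‖z‖ ≥ 0`, imaginary part `arg z ∈ (-π, π]`).
[folklore] -/
theorem norm_log_le_log_norm_add_pi {z : ℂ} (hz : 1 ≤ ‖z‖) :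
    ‖log z‖ ≤ Real.log ‖z‖ + Real.pi := by
  have h1 : ‖log z‖ ≤ |(log z).re| + |(log z).im| := Complex.norm_le_abs_re_add_abs_im _
  rw [Complex.log_re, Complex.log_im] at h1
  have h2 : |Real.log ‖z‖| = Real.log ‖z‖ := abs_of_nonneg (Real.log_nonneg hz)
  have h3 : |arg z| ≤ Real.pi := Complex.abs_arg_le_pi z
  linarith

/-- **Core perturbation lemma** (the Newton/contraction step). If `exp (x₀ⱼ) = αⱼ ≠ 0`, the
`Pⱼ` are entire, and on the unit polydisc around `x₀` both `‖aⱼ‖ (‖ℓⱼ‖ + 1)` and `‖Pⱼ‖` are at most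
`‖αⱼ‖ / (32 (s + 1))`, then the system `exp (xⱼ) = αⱼ + aⱼ (ℓⱼ + xⱼ - x₀ⱼ) + Pⱼ(x)` (`j < s`) has
a solution with `‖x - x₀‖ ≤ 1/2`. Reduction to the fixed-point lemma
`Literature.NumberTheory.Transcendental.ExpDominant.exists_exp_eq_one_add` (D'Aquino–Fornasiero–Terzo
2018, Lemma 2.2, contraction form). [cite: DaquinoFornasieroTerzo2017, Lemma 2.2] -/
theorem exists_exp_eq_affine_add {s : ℕ} (x₀ ℓ a α : Fin s → ℂ) (P : Fin s → (Fin s → ℂ) → ℂ)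
    (hα : ∀ j, exp (x₀ j) = α j) (hα0 : ∀ j, α j ≠ 0)
    (hP : ∀ j, Differentiable ℂ (P j))
    (ha : ∀ j, ‖a j‖ * (‖ℓ j‖ + 1) ≤ ‖α j‖ / (32 * (s + 1)))
    (hPb : ∀ j, ∀ ξ : Fin s → ℂ, ‖ξ‖ < 1 → ‖P j (x₀ + ξ)‖ ≤ ‖α j‖ / (32 * (s + 1))) :
    ∃ ξ : Fin s → ℂ, ‖ξ‖ ≤ 1 / 2 ∧
      ∀ j, exp (x₀ j + ξ j) = α j + a j * (ℓ j + ξ j) + P j (x₀ + ξ) := by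
  set g : Fin s → (Fin s → ℂ) → ℂ := fun j ξ => (a j * (ℓ j + ξ j) + P j (x₀ + ξ)) / α j with hg
  have hgdiff : ∀ j, DifferentiableOn ℂ (g j) (ball 0 1) := by
    intro j
    have h1 : Differentiable ℂ fun ξ : Fin s → ℂ => a j * (ℓ j + ξ j) :=
      (differentiable_const _).mul ((differentiable_const _).add (differentiable_apply j))
    have h2 : Differentiable ℂ fun ξ : Fin s → ℂ => P j (x₀ + ξ) :=
      (hP j).comp ((differentiable_const _).add differentiable_id)
    have h3 : Differentiable ℂ fun ξ : Fin s → ℂ => (a j * (ℓ j + ξ j) + P j (x₀ + ξ)) * (α j)⁻¹ :=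
      (h1.add h2).mul_const _
    refine (h3.differentiableOn).congr fun ξ _ => ?_
    show (a j * (ℓ j + ξ j) + P j (x₀ + ξ)) / α j = _
    rw [div_eq_mul_inv]
  have hgbound : ∀ j, ∀ ξ ∈ ball (0 : Fin s → ℂ) 1, ‖g j ξ‖ ≤ 1 / (16 * (s + 1)) := by
    intro j ξ hξ
    rw [mem_ball, dist_zero_right] at hξ
    have hξj : ‖ξ j‖ ≤ 1 := (norm_le_pi_norm ξ j).trans hξ.le
    have hαpos : 0 < ‖α j‖ := norm_pos_iff.mpr (hα0 j)
    show ‖(a j * (ℓ j + ξ j) + P j (x₀ + ξ)) / α j‖ ≤ _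
    rw [norm_div, div_le_iff₀ hαpos]
    calc ‖a j * (ℓ j + ξ j) + P j (x₀ + ξ)‖
        ≤ ‖a j‖ * (‖ℓ j‖ + ‖ξ j‖) + ‖P j (x₀ + ξ)‖ := by
          refine (norm_add_le _ _).trans (add_le_add ?_ le_rfl)
          rw [norm_mul]
          exact mul_le_mul_of_nonneg_left (norm_add_le _ _) (norm_nonneg _)
      _ ≤ ‖a j‖ * (‖ℓ j‖ + 1) + ‖P j (x₀ + ξ)‖ := by gcongr
      _ ≤ ‖α j‖ / (32 * (s + 1)) + ‖α j‖ / (32 * (s + 1)) := add_le_add (ha j) (hPb j ξ hξ)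
      _ = 1 / (16 * (s + 1)) * ‖α j‖ := by field_simp; ring
  obtain ⟨ξ, hξ, hfix⟩ := Literature.NumberTheory.Transcendental.ExpDominant.exists_exp_eq_one_add
    g (ε := 1 / (16 * (s + 1))) (by positivity) (le_of_eq (by field_simp)) hgdiff hgbound
  refine ⟨ξ, hξ, fun j => ?_⟩
  rw [Complex.exp_add, hα j, hfix j, hg, mul_add, mul_one, mul_div_cancel₀ _ (hα0 j), add_assoc]

/-! ### The affine lattice sequence `αₘ = a (2πi q m) + b` -/

/-- Norm of the lattice point `m · 2πi q`. [folklore] -/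
theorem norm_natCast_mul_twoPiI_mul_intCast (m : ℕ) (q : ℤ) :
    ‖(m : ℂ) * (2 * Real.pi * I * (q : ℂ))‖ = (m : ℝ) * (2 * Real.pi * |(q : ℝ)|) := by
  rw [norm_mul, Complex.norm_natCast, norm_mul, norm_mul, norm_mul, Complex.norm_I, mul_one,
    Complex.norm_intCast, Complex.norm_real, Real.norm_of_nonneg Real.pi_pos.le, Complex.norm_two]

/-- `exp (m · 2πi q) = 1`. [folklore] -/
theorem exp_natCast_mul_twoPiI_mul_intCast (m : ℕ) (q : ℤ) :
    exp ((m : ℂ) * (2 * Real.pi * I * (q : ℂ))) = 1 := by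
  have : (m : ℂ) * (2 * Real.pi * I * (q : ℂ)) = ((m * q : ℤ) : ℂ) * (2 * Real.pi * I) := by
    push_cast; ring
  rw [this]
  exact Complex.exp_int_mul_two_pi_mul_I _

/-- If `a ≠ 0` and `q ≠ 0` then `‖a (2πi q m) + b‖ → ∞`. [folklore] -/
theorem tendsto_norm_affineSeq {a b : ℂ} {q : ℤ} (ha : a ≠ 0) (hq : q ≠ 0) :
    Tendsto (fun m : ℕ => ‖a * ((m : ℂ) * (2 * Real.pi * I * (q : ℂ))) + b‖) atTop atTop := by
  have hc : 0 < ‖a‖ * (2 * Real.pi * |(q : ℝ)|) := by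
    have : (0 : ℝ) < |(q : ℝ)| := by exact_mod_cast abs_pos.mpr hq
    positivity
  have hlin : Tendsto (fun m : ℕ => ‖a‖ * (2 * Real.pi * |(q : ℝ)|) * (m : ℝ) + -‖b‖) atTop atTop :=
    (tendsto_natCast_atTop_atTop.const_mul_atTop hc).atTop_add tendsto_const_nhds
  refine tendsto_atTop_mono (fun m => ?_) hlin
  have h1 : ‖a * ((m : ℂ) * (2 * Real.pi * I * (q : ℂ)))‖ = ‖a‖ * (2 * Real.pi * |(q : ℝ)|) * m := by
    rw [norm_mul, norm_natCast_mul_twoPiI_mul_intCast]; ring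
  have h2 := norm_add_le (a * ((m : ℂ) * (2 * Real.pi * I * (q : ℂ))) + b) (-b)
  rw [add_neg_cancel_right, norm_neg, h1] at h2
  linarith

/-- `(log r + c) / r → 0` as `r → ∞`. [folklore] -/
theorem tendsto_log_add_const_div_atTop (c : ℝ) :
    Tendsto (fun r : ℝ => (Real.log r + c) / r) atTop (𝓝 0) := by
  have h1 : Tendsto (fun r : ℝ => Real.log r / r) atTop (𝓝 0) :=
    Real.isLittleO_log_id_atTop.tendsto_div_nhds_zero
  have h2 : Tendsto (fun r : ℝ => c / r) atTop (𝓝 0) := tendsto_const_nhds.div_atTop tendsto_id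
  simpa [add_div] using h1.add h2

/-- The eventual bounds along the affine lattice sequence `αₘ = a (2πi q m) + b` used in the
contraction step: (i) a uniform positive lower bound for `‖αₘ‖`, (ii)
`‖a‖ (‖log αₘ‖ + 1) ≤ κ ‖αₘ‖` for any `κ > 0`, (iii) `‖log αₘ‖ ≤ δ m` for any `δ > 0`.
[folklore] -/
theorem eventually_affineSeq_bounds {a b : ℂ} {q : ℤ} (haq : a ≠ 0 → q ≠ 0) (hab : a = 0 → b ≠ 0)
    {κ δ : ℝ} (hκ : 0 < κ) (hδ : 0 < δ) :
    ∃ μ : ℝ, 0 < μ ∧ ∀ᶠ m : ℕ in atTop,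
      μ ≤ ‖a * ((m : ℂ) * (2 * Real.pi * I * (q : ℂ))) + b‖ ∧
      ‖a‖ * (‖log (a * ((m : ℂ) * (2 * Real.pi * I * (q : ℂ))) + b)‖ + 1) ≤
        κ * ‖a * ((m : ℂ) * (2 * Real.pi * I * (q : ℂ))) + b‖ ∧
      ‖log (a * ((m : ℂ) * (2 * Real.pi * I * (q : ℂ))) + b)‖ ≤ δ * m := by
  by_cases ha : a = 0
  · -- constant sequence `αₘ = b ≠ 0`
    have hb : b ≠ 0 := hab ha
    refine ⟨‖b‖, norm_pos_iff.mpr hb, ?_⟩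
    have hev : ∀ᶠ m : ℕ in atTop, ‖log b‖ ≤ δ * m := by
      have ht : Tendsto (fun m : ℕ => δ * (m : ℝ)) atTop atTop :=
        tendsto_natCast_atTop_atTop.const_mul_atTop hδ
      exact ht.eventually_ge_atTop ‖log b‖
    filter_upwards [hev] with m hm
    simp only [ha, zero_mul, zero_add, norm_zero]
    exact ⟨le_rfl, by positivity, hm⟩
  · -- growing sequence
    have hq : q ≠ 0 := haq ha
    set α : ℕ → ℂ := fun m => a * ((m : ℂ) * (2 * Real.pi * I * (q : ℂ))) + b with hα
    have hT : Tendsto (fun m => ‖α m‖) atTop atTop := tendsto_norm_affineSeq ha hq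
    refine ⟨1, one_pos, ?_⟩
    have hev1 : ∀ᶠ m : ℕ in atTop, 1 ≤ ‖α m‖ := hT.eventually_ge_atTop 1
    -- (ii): `(log ‖αₘ‖ + π + 1) / ‖αₘ‖ ≤ κ / ‖a‖` eventually
    have hκa : 0 < κ / ‖a‖ := div_pos hκ (norm_pos_iff.mpr ha)
    have hev2 : ∀ᶠ m : ℕ in atTop, (Real.log ‖α m‖ + (Real.pi + 1)) / ‖α m‖ ≤ κ / ‖a‖ :=
      (hT.eventually (p := fun r => (Real.log r + (Real.pi + 1)) / r ≤ κ / ‖a‖)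
        ((tendsto_log_add_const_div_atTop (Real.pi + 1)).eventually (eventually_le_nhds hκa)))
    -- (iii): `‖αₘ‖ ≤ C m`, `log (C m) + π ≤ δ m` eventually
    set C : ℝ := ‖a‖ * (2 * Real.pi * |(q : ℝ)|) + ‖b‖ with hC
    have hCpos : 0 < C := by
      have : (0 : ℝ) < |(q : ℝ)| := by exact_mod_cast abs_pos.mpr hq
      have := norm_pos_iff.mpr ha
      positivity
    have hαle : ∀ m : ℕ, 1 ≤ m → ‖α m‖ ≤ C * m := by
      intro m hm
      have hm' : (1 : ℝ) ≤ m := by exact_mod_cast hm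
      calc ‖α m‖ ≤ ‖a * ((m : ℂ) * (2 * Real.pi * I * (q : ℂ)))‖ + ‖b‖ := norm_add_le _ _
        _ = ‖a‖ * (2 * Real.pi * |(q : ℝ)|) * m + ‖b‖ := by
            rw [norm_mul, norm_natCast_mul_twoPiI_mul_intCast]; ring
        _ ≤ ‖a‖ * (2 * Real.pi * |(q : ℝ)|) * m + ‖b‖ * m := by
            gcongr; exact le_mul_of_one_le_right (norm_nonneg _) hm'
        _ = C * m := by rw [hC]; ring
    have hev3 : ∀ᶠ m : ℕ in atTop, (Real.log C + Real.pi + Real.log m) ≤ δ * m := by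
      have h0 : Tendsto (fun r : ℝ => (Real.log r + (Real.log C + Real.pi)) / r) atTop (𝓝 0) :=
        tendsto_log_add_const_div_atTop _
      have h1 := (h0.comp tendsto_natCast_atTop_atTop).eventually (eventually_le_nhds hδ)
      have h2 : ∀ᶠ m : ℕ in atTop, 1 ≤ m := eventually_ge_atTop 1
      filter_upwards [h1, h2] with m hm hm1
      have hm' : (0 : ℝ) < m := by exact_mod_cast hm1
      have := (div_le_iff₀ hm').mp hm
      linarith
    filter_upwards [hev1, hev2, hev3, eventually_ge_atTop 1] with m hm1 hm2 hm3 hm4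
    have hlog : ‖log (α m)‖ ≤ Real.log ‖α m‖ + Real.pi := norm_log_le_log_norm_add_pi hm1
    have hαpos : 0 < ‖α m‖ := by linarith
    refine ⟨hm1, ?_, ?_⟩
    · have h := (div_le_iff₀ hαpos).mp hm2
      have ha' : 0 < ‖a‖ := norm_pos_iff.mpr ha
      calc ‖a‖ * (‖log (α m)‖ + 1) ≤ ‖a‖ * (Real.log ‖α m‖ + (Real.pi + 1)) :=
            mul_le_mul_of_nonneg_left (by linarith) (norm_nonneg _)
        _ ≤ ‖a‖ * (κ / ‖a‖ * ‖α m‖) := by gcongr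
        _ = κ * ‖α m‖ := by field_simp
    · have hm4' : (1 : ℝ) ≤ m := by exact_mod_cast hm4
      have hlogle : Real.log ‖α m‖ ≤ Real.log C + Real.log m := by
        rw [← Real.log_mul hCpos.ne' (by positivity)]
        exact Real.log_le_log hαpos (hαle m hm4)
      linarith

/-! ### Auxiliary analysis -/

/-- `x ↦ (f x, x₁, …, xₛ)` is differentiable when `f` is. [folklore] -/
theorem differentiable_finCons {s : ℕ} {f : (Fin s → ℂ) → ℂ} (hf : Differentiable ℂ f) :
    Differentiable ℂ fun x : Fin s → ℂ => (Fin.cons (f x) x : Fin (s + 1) → ℂ) := by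
  refine differentiable_pi.2 fun i => ?_
  refine Fin.cases ?_ (fun j => ?_) i
  · simp only [Fin.cons_zero]; exact hf
  · simp only [Fin.cons_succ]; exact differentiable_apply j

/-- `mᴺ e^{-c m} → 0` (`c > 0`), in the form used below. [folklore] -/
theorem tendsto_pow_div_exp_natCast (N : ℕ) {c : ℝ} (hc : 0 < c) :
    Tendsto (fun m : ℕ => (m : ℝ) ^ N / Real.exp (c * m)) atTop (𝓝 0) :=
  ((isLittleO_pow_exp_pos_mul_atTop N hc).tendsto_div_nhds_zero).comp tendsto_natCast_atTop_atTop

/-- Sup-norm of `(e, x₁, …, xₛ)` when `‖e‖ ≤ 1` and `‖x‖ ≤ R`, `R ≥ 0`: at most `1 + R`. [folklore] -/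
theorem norm_finCons_le {s : ℕ} {e : ℂ} {x : Fin s → ℂ} {R : ℝ} (he : ‖e‖ ≤ 1) (hR : 0 ≤ R)
    (hx : ‖x‖ ≤ R) : ‖(Fin.cons e x : Fin (s + 1) → ℂ)‖ ≤ 1 + R := by
  rw [pi_norm_le_iff_of_nonneg (by positivity)]
  intro i
  refine Fin.cases ?_ (fun j => ?_) i
  · rw [Fin.cons_zero]; linarith
  · rw [Fin.cons_succ]; exact (norm_le_pi_norm x j).trans (by linarith)

end Summit.Schanuel.Schanuel.Theorems
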